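import Mathlib
import Summits.NavierStokesRegularity.NavierStokesRegularity.Theorems.TaoLadderRungTwoFlatEnvelopeSplit
import Summits.NavierStokesRegularity.NavierStokesRegularity.Theorems.TaoLadderRungTwoFlatCoScaledReference
import HarnessLib

/-!
# THE HOP STEP OF THE SPLIT R54 TUBE AT `n > N₀`, ONE CALL: clock ∧ envelope ∧ landing with the co-scaled reference family
  INSTANTIATED (`W_z := scaleFam (anchorScale P i₀ z) U`, `U` one exact flow of the pulse `u⋆`)
  (helper for the K_A♭ parent item stmt-NavierStokesRegularity-22987 `FlatGapCertificatesV2`, child 2A `GradedAdiabaticWakeA` of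
  route TaoLadderRungTwoFlat; cell harvest/h2-tao-ladder, p1 g25; LADDER §50, §59–§66)

The three per-hop obligations of `HopTube.stepToWith_of_obligations` at a hop `n > N₀` (capture vacuous) each have an assembled
producer in the tree: CLOCK `tubeStepClockWith_of_carrier`, ENVELOPE `tubeStepEnvelopeWith_of_schedule_slot` (p725424), LANDING
`tubeStepLandWith_of_schedule_split` (p724265). This module composes them ONCE, over the union of their hypothesis lists, and at the same
time INSTANTIATES the (α) reference family of TRAP #25 by the co-scaled pulse flow `W_z := x_z·U(x_z·)`, `x_z = anchorScale P i₀ z`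
(`…CoScaledReference`): the family hypotheses `hWflow` (exact zero-slack flow on `[0, c₀]`), `hM`/`hM₁`/`hM₂` (template bounds), `hEW`
(start mismatch energy, `= 0`) and the section datum `hsec` (wired to its sharp producer `interfaceStart_le_of_coreClauseFrom`, referee c97)
are DISCHARGED from: one exact flow `U` of `u⋆` on `[0, τ_U] ⊇ [0, c₀]` (child 1), template bounds on `U`, `γ n < 1`, and a gauge floor
`ω₁ ≤ ω(1−K)`. The clock's carrier input is read from the landing's carrier bound through `1 + σ ≤ A_*(1 − γ(n+1))`.

* `tubeStep_of_schedule_split` — `TubeStepClockWith ∧ TubeStepEnvelopeWith ∧ TubeStepLandWith` of the split tube at the choice rule;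
* `stepTo_of_tubeStep` — hence, along every premise at hop `n`, the format's `StepTo … ∧ (1+σ)·a ≤ |S i₀ 1 τ₁|`
  (`stepToWith_of_obligations`, capture vacuous).

WHAT REMAINS HYPOTHESIS (by kind). E2 readouts along the premise flows (section times `hex`/`hwin`, carrier `hcarrier`, in-hop core
input `hcore2`, reference wake residuals `hRT`/`hRW` of the CO-SCALED pulse flow, core landing contract `hland`, ahead window `hwinA`/`hVt`,
in-hop window hull `hhull`); the pulse flow `U` with its template bounds (child 1); scalar rows (near/behind dictionary
`Schedule61.scheduleRowIface_sound`, `hcoreland`, `hwake`, `hle`, cut schedule, envelope rows, budgets).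

HONEST FRAMING: composition over the cell's typed induction frame (MODEL lattice, graded mirror table on `S♭`, `m = 2`); nothing certified;
no item closed; nothing about the Navier–Stokes equations.
-/

noncomputable section

-- the sub-problem namespace repeats the summit name by design (D-0017)
set_option linter.dupNamespace false

namespace Summit.NavierStokesRegularity.NavierStokesRegularity.Theorems.HopTube

open Set Finset Literature.Analysis.FluidPDE Literature.Analysis.FluidPDE.TaoCascade MirrorPulse GappedFrontRobustOn FlowSymmetry

section Step

variable {ε ε₀ : ℝ}

/-- **The section datum at time `0` of a premise against the co-scaled pulse flow** (`hsec`, wired): along a premise of the split tube at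
hop `n > N₀`, `|(S − x_z·U(x_z·))ᵢ(1−K)(0)| = |S₀ᵢ(1−K) − x_z·u⋆ᵢ(1−K)| ≤ r + δs(n)/ω₁` (kick + sharp row at `1−K`; the co-scaled start
mismatch is `0`). [cite: Tao2016AveragedNS, §6.3–6.4 (statement shape); cell LADDER §61 (`hsec`), §64 (TRAP #25 (α), #25b)] -/
theorem interfaceStart_le_coScaled (P : TubeSchedule) {θ' : ℝ} {Wb : ℕ → ℝ} {δs : ℕ → ℝ} {i₀ : Fin 2}
    {X₀ : Fin 2 → ℝ} {w : ℤ → ℝ} {r c₀ τU : ℝ} {ζ : ℕ → Fin 2 → ℤ → ℝ} {ustar : Fin 2 → ℤ → ℝ} {n : ℕ}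
    {U FU : Fin 2 → ℤ → ℝ → ℝ}
    (hU : PseudoFlowOnShift shiftSetFlat τU ε₀ (mirrorTable ε ε) 0 0 ustar (fun i k => (1 / 2) * ustar i k ^ 2) (fun _ _ => 0) U FU)
    (hn : P.N₀ < n) (hw1 : ∀ k, 1 ≤ w k) {ω₁ rs : ℝ} (hω₁ : 0 < ω₁)
    (hω₁le : ∀ i, ω₁ ≤ MirrorPulse.geomGauge P.g P.b i (1 - (P.K : ℤ))) (hrs : r + δs n / ω₁ ≤ rs) :
    ∀ z S₀ τ S F, HopPremiseWith P (splitBcl P (behindR54 P θ' Wb) δs i₀ ustar) shiftSetFlat ε₀ i₀ (mirrorTable ε ε) X₀ w r c₀ ζ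
      ustar n z S₀ τ S F → ∀ i, |(S - scaleFam (anchorScale P i₀ z) U) i (1 - (P.K : ℤ)) 0| ≤ rs := by
  intro z S₀ τ S F hprem i
  obtain ⟨hz, hkick, -, hflow⟩ := hprem
  have h0 : n ≠ 0 := by omega
  have h1 : ¬ n ≤ P.N₀ := by omega
  simp only [InTubeWith, h0, if_false, h1] at hz
  obtain ⟨-, -, -, ⟨-, hcore⟩, -⟩ := hz
  have e : (S - scaleFam (anchorScale P i₀ z) U) i (1 - (P.K : ℤ)) 0
      = S₀ i (1 - (P.K : ℤ)) - anchorScale P i₀ z * ustar i (1 - (P.K : ℤ)) := by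
    simp only [Pi.sub_apply, scaleFam, mul_zero, hflow.init_S, hU.init_S]
  rw [e]
  have h := interfaceStart_le_of_coreClauseFrom P (W₀ := fun i k => anchorScale P i₀ z * ustar i k) (E₁ := 0) hcore hω₁
    hω₁le hkick hw1 (fun i => by simp) i
  linarith

/-- **THE HOP STEP OF THE SPLIT R54 TUBE AT `n > N₀`, ONE CALL**: `TubeStepClockWith ∧ TubeStepEnvelopeWith ∧ TubeStepLandWith` of the
tube `InTubeWith P (splitBcl P (behindR54 P θ′ Wb) δs i₀ u⋆)` (`P` the weak schedule) at the choice rule, with the reference family the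
CO-SCALED pulse flow `W_z := scaleFam (anchorScale P i₀ z) U`. See the module docstring for what is discharged and what remains hypothesis.
[cite: Tao2016AveragedNS, §6.3–6.4 Props. 6.4–6.5 (statement shape of the inductive step); cell LADDER §50, §59–§66; route TaoLadderRungTwoFlat] -/
theorem tubeStep_of_schedule_split (P : TubeSchedule) {θ' : ℝ} {Wb : ℕ → ℝ} {δs : ℕ → ℝ} {i₀ : Fin 2}
    {X₀ : Fin 2 → ℝ} {w : ℤ → ℝ} {σ r θ₀ c₀ t₀ τU : ℝ} {ζ : ℕ → Fin 2 → ℤ → ℝ} {ustar : Fin 2 → ℤ → ℝ}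
    {good : ℕ → (Fin 2 → ℤ → ℝ → ℝ) → ℝ → Prop} {n : ℕ} {U FU : Fin 2 → ℤ → ℝ → ℝ}
    -- the pulse flow (child 1): one exact zero-slack flow of `u⋆` on `[0, τ_U] ⊇ [0, c₀]`, and its template bounds
    (hU : PseudoFlowOnShift shiftSetFlat τU ε₀ (mirrorTable ε ε) 0 0 ustar (fun i k => (1 / 2) * ustar i k ^ 2) (fun _ _ => 0) U FU)
    (hc₀ : 0 < c₀) (hc₀U : c₀ ≤ τU)
    {M M₁ M₂ : ℝ}
    (hMU : ∀ s ∈ Icc 0 c₀, ∀ i, ∀ m ∈ Finset.Icc (-(P.D : ℤ)) (1 - (P.K : ℤ)), |U i m s| ≤ M)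
    (hM₁U : ∀ s ∈ Icc 0 c₀, |U 1 (-(P.K : ℤ)) s| ≤ M₁) (hM₂U : ∀ s ∈ Icc 0 c₀, |U 0 (2 - (P.K : ℤ)) s| ≤ M₂)
    -- statics
    (hε : 0 ≤ ε) (hε₀ : 0 < ε₀) (hn : P.N₀ < n) (hK : 1 ≤ P.K) (hDK : P.K + 1 ≤ P.D) (hθV : 0 < P.θV)
    (hθ : 0 < θ') (hθ5 : θ' ≤ 5 * Real.log (1 + ε₀)) (hw1 : ∀ k, 1 ≤ w k) (hr0 : 0 ≤ r)
    (hAstar : 0 < P.Astar) (hg : 0 < P.g) (hb : 0 < P.b) {ωK ω₁ MuK : ℝ} (hωK : 0 < ωK)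
    (hωKle : ∀ i, ωK ≤ MirrorPulse.geomGauge P.g P.b i (-(P.K : ℤ))) (hMuK : ∀ i, |ustar i (-(P.K : ℤ))| ≤ MuK)
    (hω₁ : 0 < ω₁) (hω₁le : ∀ i, ω₁ ≤ MirrorPulse.geomGauge P.g P.b i (1 - (P.K : ℤ)))
    (hWbn : 0 ≤ Wb n) (hWbn1 : 0 ≤ Wb (n + 1)) (hvn1 : 0 ≤ P.v (n + 1)) (hδn1 : 0 ≤ P.δ (n + 1))
    (hγn : P.γ n < 1) (hγ : 0 ≤ P.γ (n + 1)) (hθ₀ : 0 ≤ θ₀) (hθ₀1 : θ₀ ≤ 1) (hAFL : 0 < 1 - θ₀ * ε₀)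
    (hσ : 0 ≤ σ) (hσγ : 1 + σ ≤ P.Astar * (1 - P.γ (n + 1)))
    -- good section times exist and lie in the clock window (E2)
    {tlo : ℝ} (htlo : 0 < tlo)
    (hex : ∀ z S₀ τ S F, HopPremiseWith P (splitBcl P (behindR54 P θ' Wb) δs i₀ ustar) shiftSetFlat ε₀ i₀ (mirrorTable ε ε) X₀ w r c₀ ζ
      ustar n z S₀ τ S F → ∃ t, good n S t)
    (hwin : ∀ z S₀ τ S F, HopPremiseWith P (splitBcl P (behindR54 P θ' Wb) δs i₀ ustar) shiftSetFlat ε₀ i₀ (mirrorTable ε ε) X₀ w r c₀ ζ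
      ustar n z S₀ τ S F → ∀ t, good n S t → tlo ≤ t ∧ t ≤ c₀)
    -- ANCHOR/CLOCK: the new-head carrier lower bound at good times (E2)
    (hcarrier : ∀ z S₀ τ S F, HopPremiseWith P (splitBcl P (behindR54 P θ' Wb) δs i₀ ustar) shiftSetFlat ε₀ i₀ (mirrorTable ε ε) X₀ w r c₀ ζ
      ustar n z S₀ τ S F → ∀ t, good n S t → P.Astar * (1 - P.γ (n + 1)) * (1 + ε₀) ^ (-θ₀) ≤ |S i₀ 1 t|)
    -- NEAR/BEHIND (interface loop of record): deeper core input (E2), interface levels, rows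
    {Aeff A A₀ A₁ rI RBAR BBAR RHO2 rs I₁ I₂ PUMP μN μB VbarN VbarB RT V₀N V₀B EN : ℝ}
    (hAeff : 0 < Aeff) (hrs : r + δs n / ω₁ ≤ rs) (hρ0 : 0 ≤ RHO2)
    (hcore2 : ∀ z S₀ τ S F, HopPremiseWith P (splitBcl P (behindR54 P θ' Wb) δs i₀ ustar) shiftSetFlat ε₀ i₀ (mirrorTable ε ε) X₀ w r c₀ ζ
      ustar n z S₀ τ S F → ∀ t, good n S t → ∀ s ∈ Icc 0 t, |(S - scaleFam (anchorScale P i₀ z) U) 0 (2 - (P.K : ℤ)) s| ≤ RHO2)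
    (hRB0 : 0 ≤ RBAR) (hBB0 : 0 ≤ BBAR) (hRr : RBAR ≤ rI) (hBr : BBAR ≤ rI) (hVN0 : 0 ≤ VbarN)
    (hI₁0 : 0 ≤ I₁) (hI₂0 : 0 ≤ I₂)
    (hI₁ : 2 * (Real.exp (P.θV / 2) - 1) ≤ I₁ * P.θV) (hI₂ : Real.exp P.θV - 1 ≤ I₂ * P.θV)
    (hPUMPdef : PUMP = 1 * c₀ * ((2 + ε) * M * I₁ * Real.sqrt (2 * VbarN) + 2 * I₂ * VbarN))
    (hlevC : rs + PUMP + 1 * c₀ * ((ε * (M + I₁ * Real.sqrt (2 * VbarN)) + ε * M + ε * BBAR) * RBAR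
      + (2 + ε) * M * BBAR + BBAR ^ 2) < RBAR)
    (hlevV : rs + 1 * c₀ * ((M + M₂ + RBAR + RHO2) * BBAR + (1 + 2 * ε) * M * RBAR + ε * RBAR ^ 2
      + (M + 2 * ε * M₂) * RHO2 + ε * RHO2 ^ 2) < BBAR)
    (hRT : ∀ z S₀ τ S F, HopPremiseWith P (splitBcl P (behindR54 P θ' Wb) δs i₀ ustar) shiftSetFlat ε₀ i₀ (mirrorTable ε ε) X₀ w r c₀ ζ
      ustar n z S₀ τ S F → ∀ t, good n S t →
        ∑ k ∈ Finset.Icc (-(P.D : ℤ)) (-(P.K : ℤ) - 1), Real.exp (P.θV * ((k : ℝ) + P.K)) *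
          ∑ i : Fin 2, (scaleFam (anchorScale P i₀ z) U i (1 + k) t - |S i₀ 1 t| / P.Astar * ustar i k) ^ 2 / 2 ≤ RT)
    (hAdef : A = Real.sqrt (2 * VbarB) * Real.exp (θ' / 2) * Real.exp (θ' * ((P.D : ℝ) - P.K) / 2) + M)
    (hA₀def : A₀ = M + rI) (hA₁def : A₁ = M₁ + Real.sqrt (2 * VbarN) * Real.exp (P.θV / 2))
    (hrA : rI ≤ A) (hA₀le : A₀ ≤ Aeff)
    (hV₀Ndef : V₀N = (Real.sqrt (P.v n + (P.δ n / ωK) ^ 2) + Real.sqrt P.D * r) ^ 2)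
    (hV₀Bdef : V₀B = (Real.sqrt (Wb n + (MuK + P.δ n / ωK) ^ 2) + r / Real.sqrt (1 - Real.exp (-θ'))) ^ 2)
    (hENdef : EN = Real.exp (P.θV * ((1 : ℝ) - P.D + P.K)) * ((1 + ε) * 1 * A ^ 2 * (A + M))
      + 1 * rI * (2 * VbarN + ε * rI * Real.sqrt (2 * VbarN) + (1 + ε) * M * rI))
    (hμN : 0 < μN)
    (hμNle : μN ≤ (1 / c₀) * P.θV - 2 * (1 + ε) * 1 * (A * Real.sinh (P.θV / 2) + M * (3 + Real.exp P.θV)))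
    (hμB : 0 < μB) (hμBle : μB ≤ (1 / c₀) * θ' - 2 * (1 + ε) * Aeff * Real.sinh (θ' / 2))
    (hlevN : V₀N + EN * c₀ < VbarN) (hlevB : V₀B + A₁ * A₀ * (A₁ + ε * A₀) * c₀ < VbarB)
    (hclose : Real.sqrt (2 * VbarB) * Real.exp (θ' / 2) ≤ Aeff)
    (hbudgetN : ∀ t ∈ Icc tlo c₀, (Real.sqrt (Real.exp (-μN * t) * V₀N + EN * (1 - Real.exp (-μN * t)) / μN)
      + Real.sqrt RT) ^ 2 ≤ (1 - θ₀ * ε₀) ^ 2 * P.v (n + 1))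
    (hbudgetB : ∀ t ∈ Icc tlo c₀, Real.exp (-μB * t) * V₀B + A₁ * A₀ * (A₁ + ε * A₀) * (1 - Real.exp (-μB * t)) / μB
      ≤ (1 - θ₀ * ε₀) ^ 2 * Wb (n + 1))
    -- CORE (sharp rows): the landing contract (E2) against the co-scaled pulse flow, at the interface levels; row P-62a
    {lev KF : Fin 2 → ℝ} {RHOC KQ DJ KI RW : ℝ} (hlev0 : RBAR ≤ lev 0) (hlev1 : BBAR ≤ lev 1)
    (hland : CoreLandingFromZ P (splitBcl P (behindR54 P θ' Wb) δs i₀ ustar) shiftSetFlat ε₀ i₀ (mirrorTable ε ε) X₀ w r c₀ ζ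
      ustar good (fun z => scaleFam (anchorScale P i₀ z) U) n lev (LandingLevel RHOC KQ DJ KI (δs n) KF lev))
    (hδs : 0 ≤ δs (n + 1)) (hle : δs (n + 1) ≤ P.δ (n + 1))
    (hcoreland : RHOC * (δs n + KI) + (KF 0 * lev 0 + KF 1 * lev 1) + KQ * (δs n + KI) ^ 2 + DJ
      ≤ (1 - θ₀ * ε₀) * δs (n + 1))
    -- CORE (wake row k = −K): the co-scaled pulse flow's own wake residual (E2, reference-only) and the row `hwake`
    (hRW : ∀ z S₀ τ S F, HopPremiseWith P (splitBcl P (behindR54 P θ' Wb) δs i₀ ustar) shiftSetFlat ε₀ i₀ (mirrorTable ε ε)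
      X₀ w r c₀ ζ ustar n z S₀ τ S F → ∀ t, good n S t →
        ∀ i, |scaleFam (anchorScale P i₀ z) U i (1 - (P.K : ℤ)) t - |S i₀ 1 t| / P.Astar * ustar i (-(P.K : ℤ))| ≤ RW)
    (hwake : ∀ i, geomGauge P.g P.b i (-(P.K : ℤ)) * (lev i + RW) ≤ (1 - θ₀ * ε₀) * P.δ (n + 1))
    -- AHEAD: window rows (E2), window-top hull (E2), cut schedule
    {kH : ℤ} {Vtop : ℝ} {G Ω : ℤ → ℝ} (hk₁ : (P.k₁ : ℤ) ≤ kH + 2) (hVtop : 0 ≤ Vtop) (hG0 : ∀ j, kH < j → 0 ≤ G j)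
    (hwinA : AheadWindowWith P (splitBcl P (behindR54 P θ' Wb) δs i₀ ustar) shiftSetFlat ε₀ i₀ (mirrorTable ε ε) X₀ w r c₀ ζ
      ustar good n kH (1 - θ₀ * ε₀))
    (hVt : ∀ z S₀ τ S F, HopPremiseWith P (splitBcl P (behindR54 P θ' Wb) δs i₀ ustar) shiftSetFlat ε₀ i₀ (mirrorTable ε ε) X₀ w r c₀ ζ
      ustar n z S₀ τ S F → ∀ t ∈ Icc 0 c₀, |S 1 (kH + 1) t| ≤ Vtop)
    (hΩ : ∀ j, kH < j → ∀ N : Finset ℤ, (∀ m ∈ N, j < m) → ∑ m ∈ N, (w m)⁻¹ ^ 2 ≤ Ω j)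
    (hGΩ : ∀ j, kH < j → 2 * (9 / 8 * r) ^ 2 * Ω j ≤ G j ^ 2)
    (hclose0 : 4 / 3 * c₀ * clock ε₀ (kH + 1) * Vtop * (Vtop + 2 * ε * G (kH + 1)) < G (kH + 1))
    (hcloseG : ∀ j, kH + 1 ≤ j →
      4 / 3 * c₀ * clock ε₀ (j + 1) * (2 * G j) * (2 * G j + 2 * ε * G (j + 1)) < G (j + 1))
    (hGr : ∀ k, kH < k → 8 * (w k * (2 * G k)) ≤ r * (1 - θ₀ * ε₀))
    -- ENVELOPE: the in-hop window hull (E2) and the four rows against `env₀`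
    {env₀ Hk : ℤ → ℝ}
    (hhull : ∀ z S₀ τ S F, HopPremiseWith P (splitBcl P (behindR54 P θ' Wb) δs i₀ ustar) shiftSetFlat ε₀ i₀ (mirrorTable ε ε) X₀ w r
      c₀ ζ ustar n z S₀ τ S F → ∀ t, good n S t → ∀ s ∈ Icc 0 t, ∀ (i : Fin 2) (k : ℤ), 2 - (P.K : ℤ) ≤ k → k ≤ kH + 1 →
        |S i k s| ≤ Hk k)
    (henvB : ∀ k : ℤ, k ≤ -(P.K : ℤ) →
      Real.exp (θ' * ((1 : ℝ) - P.K - k)) * (V₀B + A₁ * A₀ * (A₁ + ε * A₀) * c₀) ≤ env₀ k)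
    (henvI : (1 / 2) * (M + rI) ^ 2 ≤ env₀ (1 - (P.K : ℤ)))
    (henvW : ∀ k : ℤ, 2 - (P.K : ℤ) ≤ k → k ≤ kH + 1 → (1 / 2) * Hk k ^ 2 ≤ env₀ k)
    (henvA : ∀ m : ℤ, kH + 1 < m → 2 * G (m - 1) ^ 2 ≤ env₀ m) :
    TubeStepClockWith P (splitBcl P (behindR54 P θ' Wb) δs i₀ ustar) (choiceRule P i₀ ε₀ θ₀ t₀ good) shiftSetFlat σ ε₀ i₀
        (mirrorTable ε ε) X₀ w r θ₀ c₀ ζ ustar n ∧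
      TubeStepEnvelopeWith P (splitBcl P (behindR54 P θ' Wb) δs i₀ ustar) (choiceRule P i₀ ε₀ θ₀ t₀ good) shiftSetFlat ε₀ i₀
        (mirrorTable ε ε) X₀ w r c₀ env₀ ζ ustar n ∧
      TubeStepLandWith P (splitBcl P (behindR54 P θ' Wb) δs i₀ ustar) (choiceRule P i₀ ε₀ θ₀ t₀ good) shiftSetFlat ε₀ i₀
        (mirrorTable ε ε) X₀ w r c₀ ζ ustar n := by
  have hε₀' : (-1 : ℝ) < ε₀ := neg_one_lt_zero.trans hε₀
  have hBcl := splitBcl_fst P (behindR54 P θ' Wb) δs i₀ ustar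
  -- the tube at hop `n > N₀`: anchor band ⇒ `0 < x_z ≤ 1`
  have hx : ∀ z, InTubeWith P (splitBcl P (behindR54 P θ' Wb) δs i₀ ustar) i₀ X₀ w r ζ ustar n z →
      0 < anchorScale P i₀ z ∧ anchorScale P i₀ z ≤ 1 := by
    intro z hz
    have h0 : n ≠ 0 := by omega
    have h1 : ¬ n ≤ P.N₀ := by omega
    simp only [InTubeWith, h0, if_false, h1] at hz
    exact ⟨anchorScale_pos_of_anchorClause P hAstar hγn hz.1, anchorScale_le_one_of_anchorClause P hAstar hz.1⟩
  -- (α): the co-scaled pulse flow is an exact zero-slack flow on `[0, c₀]` from `x_z·u⋆`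
  have hWflow : ∀ z, InTubeWith P (splitBcl P (behindR54 P θ' Wb) δs i₀ ustar) i₀ X₀ w r ζ ustar n z →
      PseudoFlowOnShift shiftSetFlat c₀ ε₀ (mirrorTable ε ε) 0 0 (fun i k => anchorScale P i₀ z * ustar i k)
        (fun i k => (1 / 2) * (anchorScale P i₀ z * ustar i k) ^ 2) (fun _ _ => 0) (scaleFam (anchorScale P i₀ z) U)
        (fun i k t => (1 / 2) * scaleFam (anchorScale P i₀ z) U i k t ^ 2) := fun z hz =>
    coScaled_pseudoFlowOnShift hU hε₀'.le hc₀ hc₀U (hx z hz).1 (hx z hz).2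
  -- template bounds transfer to every member
  have hM : ∀ z, InTubeWith P (splitBcl P (behindR54 P θ' Wb) δs i₀ ustar) i₀ X₀ w r ζ ustar n z →
      ∀ s ∈ Icc 0 c₀, ∀ i, ∀ m ∈ Finset.Icc (-(P.D : ℤ)) (1 - (P.K : ℤ)), |scaleFam (anchorScale P i₀ z) U i m s| ≤ M :=
    fun z hz s hs i m hm => abs_scaleFam_le (fun s' hs' => hMU s' hs' i m hm) (hx z hz).1.le (hx z hz).2 s hs
  have hM₁ : ∀ z, InTubeWith P (splitBcl P (behindR54 P θ' Wb) δs i₀ ustar) i₀ X₀ w r ζ ustar n z →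
      ∀ s ∈ Icc 0 c₀, |scaleFam (anchorScale P i₀ z) U 1 (-(P.K : ℤ)) s| ≤ M₁ :=
    fun z hz => abs_scaleFam_le hM₁U (hx z hz).1.le (hx z hz).2
  have hM₂ : ∀ z, InTubeWith P (splitBcl P (behindR54 P θ' Wb) δs i₀ ustar) i₀ X₀ w r ζ ustar n z →
      ∀ s ∈ Icc 0 c₀, |scaleFam (anchorScale P i₀ z) U 0 (2 - (P.K : ℤ)) s| ≤ M₂ :=
    fun z hz => abs_scaleFam_le hM₂U (hx z hz).1.le (hx z hz).2
  have h0c : (0 : ℝ) ∈ Icc 0 c₀ := ⟨le_rfl, hc₀.le⟩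
  have hM0 : 0 ≤ M :=
    (abs_nonneg _).trans (hMU 0 h0c 0 (1 - (P.K : ℤ)) (by simp only [Finset.mem_Icc]; omega))
  have hM₂0 : 0 ≤ M₂ := (abs_nonneg _).trans (hM₂U 0 h0c)
  -- the start mismatch of the co-scaled member vanishes
  have hEW : ∀ z, InTubeWith P (splitBcl P (behindR54 P θ' Wb) δs i₀ ustar) i₀ X₀ w r ζ ustar n z →
      coMovingEnergyOn (Finset.Icc (1 - (P.D : ℤ)) (-(P.K : ℤ))) P.θV (-(P.K : ℝ))
        (fun i k _ => anchorScale P i₀ z * ustar i k - (fun i k => anchorScale P i₀ z * ustar i k) i k) 0 ≤ 0 :=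
    fun z _ => (coScaled_start_mismatch_eq_zero P i₀ ustar z _ _ _).le
  have hV₀Ndef' : V₀N = (Real.sqrt (P.v n + (P.δ n / ωK) ^ 2) + Real.sqrt P.D * r + Real.sqrt 0) ^ 2 := by
    rw [Real.sqrt_zero, add_zero]; exact hV₀Ndef
  -- the section datum (wired to its sharp producer)
  have hsec := interfaceStart_le_coScaled (θ' := θ') (Wb := Wb) (i₀ := i₀) (X₀ := X₀) (c₀ := c₀) (ζ := ζ) P hU hn hw1
    hω₁ hω₁le hrs
  -- CLOCK
  have hσA : 1 + σ ≤ P.Astar := hσγ.trans (mul_le_of_le_one_right hAstar.le (sub_le_self _ hγ))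
  have hwin' : ∀ z S₀ τ S F, HopPremiseWith P (splitBcl P (behindR54 P θ' Wb) δs i₀ ustar) shiftSetFlat ε₀ i₀ (mirrorTable ε ε)
      X₀ w r c₀ ζ ustar n z S₀ τ S F → ∀ t, good n S t → 0 < t ∧ t ≤ c₀ := fun z S₀ τ S F h t ht =>
    ⟨htlo.trans_le (hwin z S₀ τ S F h t ht).1, (hwin z S₀ τ S F h t ht).2⟩
  have hclock : TubeStepClockWith P (splitBcl P (behindR54 P θ' Wb) δs i₀ ustar) (choiceRule P i₀ ε₀ θ₀ t₀ good) shiftSetFlat σ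
      ε₀ i₀ (mirrorTable ε ε) X₀ w r θ₀ c₀ ζ ustar n := by
    refine tubeStepClockWith_of_carrier P hε₀' hσ hσA hex hwin' fun z S₀ τ S F h t ht => ?_
    have hf : 0 ≤ (1 + ε₀) ^ (-θ₀) := Real.rpow_nonneg (add_pos one_pos hε₀).le _
    exact (mul_le_mul_of_nonneg_right hσγ hf).trans (hcarrier z S₀ τ S F h t ht)
  -- ENVELOPE
  have henv : TubeStepEnvelopeWith P (splitBcl P (behindR54 P θ' Wb) δs i₀ ustar) (choiceRule P i₀ ε₀ θ₀ t₀ good) shiftSetFlat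
      ε₀ i₀ (mirrorTable ε ε) X₀ w r c₀ env₀ ζ ustar n :=
    tubeStepEnvelopeWith_of_schedule_slot P hBcl hWflow le_rfl hε hε₀ hn hK hDK hθV hθ hθ5 hw1 hr0 hAstar hωK hωKle hMuK hWbn
      htlo hwin hAeff hM0 hM hM₁ hM₂0 hM₂ hEW hsec hρ0 hcore2 hRB0 hBB0 hRr hBr hVN0 hI₁0 hI₂0 hI₁ hI₂ hPUMPdef hlevC hlevV
      hAdef hA₀def hA₁def hrA hA₀le hV₀Ndef' hV₀Bdef hENdef hμN hμNle hμB hμBle hlevN hlevB hclose hc₀.le hex hhull hk₁ hVtop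
      hG0 hVt hΩ hGΩ hclose0 hcloseG henvB henvI henvW henvA
  -- LANDING
  have hlandW : TubeStepLandWith P (splitBcl P (behindR54 P θ' Wb) δs i₀ ustar) (choiceRule P i₀ ε₀ θ₀ t₀ good) shiftSetFlat ε₀
      i₀ (mirrorTable ε ε) X₀ w r c₀ ζ ustar n :=
    tubeStepLandWith_of_schedule_split P (W := fun z => scaleFam (anchorScale P i₀ z) U) (lev := lev) (KF := KF)
      (RHOC := RHOC) (KQ := KQ) (DJ := DJ) (KI := KI) (RW := RW) hWflow le_rfl hε hε₀ hn hK hDK hθV hθ hθ5 hw1 hr0 hc₀.le hAstar hg hb hωK hωKle hMuK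
      hWbn hWbn1 hvn1 hδn1 hγ hθ₀ hθ₀1 hAFL htlo hex hwin hcarrier hAeff hM0 hM hM₁ hM₂0 hM₂ hEW hsec hρ0 hcore2 hRB0 hBB0
      hRr hBr hVN0 hI₁0 hI₂0 hI₁ hI₂ hPUMPdef hlevC hlevV hRT hAdef hA₀def hA₁def hrA hA₀le hV₀Ndef' hV₀Bdef hENdef hμN hμNle
      hμB hμBle hlevN hlevB hclose hbudgetN hbudgetB hlev0 hlev1 hland hδs hle hcoreland hRW hwake hk₁ hVtop hG0 hwinA hVt hΩ
      hGΩ hclose0 hcloseG hGr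
  exact ⟨hclock, henv, hlandW⟩

/-- **Hence the format step along every premise at hop `n > N₀`**: `StepTo ε₀ θ₀ c₀ i₀ (ballDesc Z w 0) (epochEnvelope env₀) S F τ₁ a`
with the slack `(1+σ)·a ≤ |S i₀ 1 τ₁|`, `Z` the split tube's described set, `(τ₁, a)` the choice rule's checkpoint
(`stepToWith_of_obligations`; the capture obligation is vacuous at `n + 1 > N₀`).
[cite: Tao2016AveragedNS, §6.4 Prop. 6.5 (statement shape); cell LADDER §50, §57.5] -/
theorem stepTo_of_tubeStep (P : TubeSchedule) {Bcl : ℕ → (Fin 2 → ℤ → ℝ) → Prop} {rule : HopRule}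
    {σ : ℝ} {i₀ : Fin 2} {X₀ : Fin 2 → ℝ} {w : ℤ → ℝ} {r θ₀ c₀ : ℝ} {env₀ : ℤ → ℝ} {ζ : ℕ → Fin 2 → ℤ → ℝ}
    {ustar : Fin 2 → ℤ → ℝ} {n : ℕ} (hn : P.N₀ < n)
    (h : TubeStepClockWith P Bcl rule shiftSetFlat σ ε₀ i₀ (mirrorTable ε ε) X₀ w r θ₀ c₀ ζ ustar n ∧
      TubeStepEnvelopeWith P Bcl rule shiftSetFlat ε₀ i₀ (mirrorTable ε ε) X₀ w r c₀ env₀ ζ ustar n ∧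
      TubeStepLandWith P Bcl rule shiftSetFlat ε₀ i₀ (mirrorTable ε ε) X₀ w r c₀ ζ ustar n)
    {z S₀ : Fin 2 → ℤ → ℝ} {τ : ℝ} {S F : Fin 2 → ℤ → ℝ → ℝ}
    (hprem : HopPremiseWith P Bcl shiftSetFlat ε₀ i₀ (mirrorTable ε ε) X₀ w r c₀ ζ ustar n z S₀ τ S F) :
    StepTo ε₀ θ₀ c₀ i₀ (ballDesc (tubeSetWith P Bcl i₀ X₀ w r ζ ustar) w (0 * r)) (epochEnvelope env₀) S F
        (rule.τ₁ n S) (rule.a n S) ∧ (1 + σ) * rule.a n S ≤ |S i₀ 1 (rule.τ₁ n S)| :=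
  stepToWith_of_obligations P Bcl rule h.1 h.2.1 (fun h' => absurd h' (by omega)) (fun _ => h.2.2) hprem

end Step

end Summit.NavierStokesRegularity.NavierStokesRegularity.Theorems.HopTube

end
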